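import Literature.Topology.FourManifolds.LatticeFormsLikeSignReflectionPairs
import Literature.Topology.FourManifolds.LatticeFormsReflectionCharacters
import Literature.Topology.FourManifolds.LatticeFormsOrthogonalGroupGenerationOriented
import HarnessLib

/-!
# `SRef₊(L) ⊆ [E_U(L₁), E_U(L₁)] ⊆ [S̃O⁺(L), S̃O⁺(L)]` for every even lattice with three hyperbolic planes:
# products of two like-sign reflections are commutator words of Eichler transvections — Thm. 1.7 (i) on the reflection part,
# without Kneser's conditions and without unimodularity
# (Gritsenko–Hulek–Sankaran, *J. Algebra* 322 (2009) Prop. 3.3 (iv), Prop. 3.4 (proof), §4.1, Thm. 1.7, Cor. 1.8; Markman, *JEMS* (2023) §7)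

Trunk T-4MAN vocabulary. The tree has, for a symmetric lattice `L ⊇ U ⊕ U₁` (`TwoHyperbolicPairs`): "the product `σ_aσ_b` of
any two reflections with `(a,a) = (b,b) = −2` belongs to `E(L)`" — `σ_aσ_b` is an admissible word in the transvections
`t(e,·), t(f,·)` (`exists_uGens_normTwoReflection_normTwoReflection_eq`, row g49-#1, either sign); and, for `L` EVEN with THREE
hyperbolic planes, "`E(L)^{ab}` is trivial": every admissible word is a word in commutators of admissible words
(`isWordIn_commutators_evalEquiv`, row g49-#6, GHS §4.1). This file composes the two and adds row g50-#10's sorting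
(`SRef₊(Λ) = ⟨like-sign pairs⟩`): for every symmetric even lattice `L` with three pairwise orthogonal hyperbolic planes —
no unimodularity, no `rank_p` conditions — **`Ref(L) ∩ SO⁺(L) ⊆ [E_U(L₁), E_U(L₁)] ⊆ [S̃O⁺(L), S̃O⁺(L)]`** as words, hence every
character of `O⁺(L)` is `1` on `SRef₊(L)`, takes one value on all `(−2)`-reflections (and every character of `O(L)` one value
on all `(+2)`-reflections), factors through `det` on `Ref₋₂(L)`, and `Ref₋₂(L)` has exactly two classes modulo
`[S̃O⁺(L), S̃O⁺(L)]`-words. (Under Kneser's conditions `Ref₋₂(L) = Õ⁺(L)` and this is Thm. 1.7 / Cor. 1.8 themselves; the tree has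
that input for `L ≅ U^{⊕n}`, rows g49-#15, g50-#2/#3.) Written for lane `lit-hodgefound` (Track 2 foundations; prover seat
`lit-hodgefound-p18`, gen 50, row g50-#12). THEOREMS ONLY — no definition, no named fact, no instance, no notation.

## Sources, verbatim

* GHS 2009 (held `paper:arxiv-0810.1614`) p. 7, proof of Prop. 3.4: "According to Proposition 3.3 (iv) the product `σ_aσ_b` of
  any two reflections with `(a,a) = (b,b) = −2` belongs to `E(L)`."; p. 4, **Theorem 1.7** "Let `L` be an even integral lattice
  containing at least two hyperbolic planes, such that `rank₂(L) ≥ 6` and `rank₃(L) ≥ 5`. Then `S̃O⁺(L)^{ab}` is trivial and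
  `Õ⁺(L)^{ab} ≅ ℤ/2ℤ`."; §4.1 (the commutator identities for `E(L)` with a third hyperbolic plane); **Cor. 1.8** "`Õ⁺(L)` has
  only one non-trivial character, namely `det`, and `S̃O⁺(L)` has no non-trivial characters."
* Markman 2023 §7 (held `paper:arxiv-1805.11574` p. 25): "`SRef₊(Λ)` is generated by elements, which are either products of an
  even number of reflections in `+2` vectors, or products of an even number of reflections in `−2` vectors."

## Contents (all proved)

* §1 (symmetric even `L` with three hyperbolic planes; any set `C` containing the commutators of admissible words) `σ_aσ_b`,
  `a² = b² = 2ε`, is a `C`-word (`isWordIn_reflection_trans_reflection_of_threeHyperbolicPairs`); so is every word in like-sign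
  pairs, every `(2ε)`-reflection word of determinant `1`, and (non-degenerate `L`) every `(±2)`-reflection word in `SO⁺`.
* §2 `C` = commutators of `S̃O⁺(L)` / of `O⁺(L)`: **`SRef₊(L) ⊆ [S̃O⁺(L), S̃O⁺(L)]`-words**; characters of `O⁺(L)` are `1` there,
  agree on all `(−2)`-reflections, factor through `det` on `Ref₋₂(L)`; characters of `O(L)` agree on all `(+2)`-reflections;
  `|Ref₋₂(L) / [S̃O⁺(L), S̃O⁺(L)]-words| = 2`.
* §3 even unimodular lattices with `n± ≥ 3` contain three pairwise orthogonal hyperbolic pairs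
  (`exists_threeHyperbolicPairs_of_isEven_of_isUnimodular`), so **`SRef₊(II_{p,q}) ⊆ [SO⁺, SO⁺]`-words for all `p, q ≥ 3`**.
-/

noncomputable section

open Module
open LinearMap (BilinForm)
open LinearMap.BilinForm
open LinearMap.BilinForm (IsometryEquiv)

namespace Literature.Topology.FourManifolds

universe u

/-! ### §1 Like-sign reflection pairs are commutator words of `E_U(L₁)` -/

section Generic

variable {W : Type*} [AddCommGroup W] {B : BilinForm ℤ W} {x y x₁ y₁ x₂ y₂ : W}

/-- **`σ_aσ_b ∈ [E_U(L₁), E_U(L₁)]` for `a² = b² = 2ε`** in a symmetric even lattice with three hyperbolic planes: `σ_aσ_b` is an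
admissible word (Prop. 3.3 (iv) / proof of Prop. 3.4) and admissible words are words in commutators of admissible words (§4.1) —
stated for any set `C` of isometries containing those commutators. [cite: GritsenkoHulekSankaran2009, Prop. 3.4 (proof, first sentence), Prop. 3.3 (iv) and §4.1 / Thm. 1.7] -/
theorem isWordIn_reflection_trans_reflection_of_threeHyperbolicPairs (h₁ : TwoHyperbolicPairs B x y x₁ y₁)
    (h₂ : TwoHyperbolicPairs B x y x₂ y₂) (h₁₂ : TwoHyperbolicPairs B x₁ y₁ x₂ y₂) (hev : B.IsEven) {C : Set (B.IsometryEquiv B)}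
    (hC : ∀ (l₁ l₂ : List (UGen W)) (hl₁ : ∀ g ∈ l₁, g.IsAdmissible B x y) (hl₂ : ∀ g ∈ l₂, g.IsAdmissible B x y),
      (((UGen.evalEquiv h₁.isSymm h₁.xx h₁.yy l₂ hl₂).symm.trans (UGen.evalEquiv h₁.isSymm h₁.xx h₁.yy l₁ hl₁).symm).trans
          (UGen.evalEquiv h₁.isSymm h₁.xx h₁.yy l₂ hl₂)).trans (UGen.evalEquiv h₁.isSymm h₁.xx h₁.yy l₁ hl₁) ∈ C)
    {a b : W} {ε : ℤ} (hε : ε * ε = 1) (ha : B a a = ε + ε) (hb : B b b = ε + ε) :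
    IsWordIn C ((normTwoReflectionEquiv h₁.isSymm a ε ha hε).trans (normTwoReflectionEquiv h₁.isSymm b ε hb hε)) := by
  obtain ⟨l, hl, hlv⟩ := exists_uGens_normTwoReflection_normTwoReflection_eq h₁ hε hb ha
  refine (isWordIn_commutators_evalEquiv h₁ h₂ h₁₂ hev hC l hl).congr fun v ↦ ?_
  rw [UGen.evalEquiv_apply, ← hlv v, LinearMap.BilinForm.IsometryEquiv.trans_apply, normTwoReflectionEquiv_apply,
    normTwoReflectionEquiv_apply, ← LinearMap.BilinForm.normTwoReflection_apply, ← LinearMap.BilinForm.normTwoReflection_apply]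

/-- **Words in products of two `(2ε)`-reflections are `C`-words** (`C` ⊇ the commutators of admissible words; symmetric even `L`
with three hyperbolic planes). [cite: GritsenkoHulekSankaran2009, Prop. 3.4 (proof) and §4.1 / Thm. 1.7] -/
theorem isWordIn_of_isWordIn_reflectionPairs_of_threeHyperbolicPairs (h₁ : TwoHyperbolicPairs B x y x₁ y₁)
    (h₂ : TwoHyperbolicPairs B x y x₂ y₂) (h₁₂ : TwoHyperbolicPairs B x₁ y₁ x₂ y₂) (hev : B.IsEven) {C : Set (B.IsometryEquiv B)}
    (hC : ∀ (l₁ l₂ : List (UGen W)) (hl₁ : ∀ g ∈ l₁, g.IsAdmissible B x y) (hl₂ : ∀ g ∈ l₂, g.IsAdmissible B x y),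
      (((UGen.evalEquiv h₁.isSymm h₁.xx h₁.yy l₂ hl₂).symm.trans (UGen.evalEquiv h₁.isSymm h₁.xx h₁.yy l₁ hl₁).symm).trans
          (UGen.evalEquiv h₁.isSymm h₁.xx h₁.yy l₂ hl₂)).trans (UGen.evalEquiv h₁.isSymm h₁.xx h₁.yy l₁ hl₁) ∈ C)
    {ε : ℤ} (hε : ε * ε = 1) {φ : B.IsometryEquiv B}
    (hφ : IsWordIn {χ : B.IsometryEquiv B | ∃ s ∈ {ψ : B.IsometryEquiv B | ∃ (r : W) (hr : B r r = ε + ε),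
        ψ = normTwoReflectionEquiv h₁.isSymm r ε hr hε}, ∃ t ∈ {ψ : B.IsometryEquiv B | ∃ (r : W) (hr : B r r = ε + ε),
        ψ = normTwoReflectionEquiv h₁.isSymm r ε hr hε}, χ = s.trans t} φ) :
    IsWordIn C φ := by
  refine hφ.bind ?_
  rintro χ ⟨s, ⟨a, ha, rfl⟩, t, ⟨b, hb, rfl⟩, rfl⟩
  exact isWordIn_reflection_trans_reflection_of_threeHyperbolicPairs h₁ h₂ h₁₂ hev hC hε ha hb

/-- **Words in LIKE-SIGN pairs of `(±2)`-reflections are `C`-words** (Markman's generators of `SRef₊(Λ)`; `C` ⊇ the commutators of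
admissible words; symmetric even `L` with three hyperbolic planes).
[cite: GritsenkoHulekSankaran2009, Prop. 3.4 (proof) and §4.1 / Thm. 1.7] [cite: Markman2023GeneralizedKummers, §7 (opening paragraph)] -/
theorem isWordIn_of_isWordIn_likeSignReflectionPairs_of_threeHyperbolicPairs (h₁ : TwoHyperbolicPairs B x y x₁ y₁)
    (h₂ : TwoHyperbolicPairs B x y x₂ y₂) (h₁₂ : TwoHyperbolicPairs B x₁ y₁ x₂ y₂) (hev : B.IsEven) {C : Set (B.IsometryEquiv B)}
    (hC : ∀ (l₁ l₂ : List (UGen W)) (hl₁ : ∀ g ∈ l₁, g.IsAdmissible B x y) (hl₂ : ∀ g ∈ l₂, g.IsAdmissible B x y),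
      (((UGen.evalEquiv h₁.isSymm h₁.xx h₁.yy l₂ hl₂).symm.trans (UGen.evalEquiv h₁.isSymm h₁.xx h₁.yy l₁ hl₁).symm).trans
          (UGen.evalEquiv h₁.isSymm h₁.xx h₁.yy l₂ hl₂)).trans (UGen.evalEquiv h₁.isSymm h₁.xx h₁.yy l₁ hl₁) ∈ C)
    {φ : B.IsometryEquiv B}
    (hφ : IsWordIn {χ : B.IsometryEquiv B | ∃ (ε : ℤ) (hε : ε * ε = 1) (a b : W) (ha : B a a = ε + ε) (hb : B b b = ε + ε),
        χ = (normTwoReflectionEquiv h₁.isSymm a ε ha hε).trans (normTwoReflectionEquiv h₁.isSymm b ε hb hε)} φ) :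
    IsWordIn C φ := by
  refine hφ.bind ?_
  rintro χ ⟨ε, hε, a, b, ha, hb, rfl⟩
  exact isWordIn_reflection_trans_reflection_of_threeHyperbolicPairs h₁ h₂ h₁₂ hev hC hε ha hb

variable [Module.Finite ℤ W] [Module.Free ℤ W]

/-- **`Ref_{2ε}(L) ∩ SO(L)`-words are `C`-words**: a word in the `(2ε)`-reflections of determinant `1` is a word in like-sign pairs
(row g50-#4), hence a `C`-word. [cite: GritsenkoHulekSankaran2009, Prop. 3.4 (proof) and Thm. 1.7] [cite: Markman2023GeneralizedKummers, §7 (opening paragraph)] -/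
theorem isWordIn_of_isWordIn_reflections_of_det_eq_one_of_threeHyperbolicPairs (h₁ : TwoHyperbolicPairs B x y x₁ y₁)
    (h₂ : TwoHyperbolicPairs B x y x₂ y₂) (h₁₂ : TwoHyperbolicPairs B x₁ y₁ x₂ y₂) (hev : B.IsEven) {C : Set (B.IsometryEquiv B)}
    (hC : ∀ (l₁ l₂ : List (UGen W)) (hl₁ : ∀ g ∈ l₁, g.IsAdmissible B x y) (hl₂ : ∀ g ∈ l₂, g.IsAdmissible B x y),
      (((UGen.evalEquiv h₁.isSymm h₁.xx h₁.yy l₂ hl₂).symm.trans (UGen.evalEquiv h₁.isSymm h₁.xx h₁.yy l₁ hl₁).symm).trans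
          (UGen.evalEquiv h₁.isSymm h₁.xx h₁.yy l₂ hl₂)).trans (UGen.evalEquiv h₁.isSymm h₁.xx h₁.yy l₁ hl₁) ∈ C)
    {ε : ℤ} (hε : ε * ε = 1) {φ : B.IsometryEquiv B}
    (hφ : IsWordIn {ψ : B.IsometryEquiv B | ∃ (r : W) (hr : B r r = ε + ε), ψ = normTwoReflectionEquiv h₁.isSymm r ε hr hε} φ)
    (hdet : LinearMap.det (φ : W →ₗ[ℤ] W) = 1) : IsWordIn C φ := by
  obtain ⟨hS, hSdet⟩ := reflections_symm_mem_and_det h₁.isSymm hε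
  exact isWordIn_of_isWordIn_reflectionPairs_of_threeHyperbolicPairs h₁ h₂ h₁₂ hev hC hε (hφ.pairs_of_det_eq_one hS hSdet hdet)

/-- **`Ref(L) ∩ SO⁺(L)`-words are `C`-words** (`L` moreover non-degenerate): a word in the `(±2)`-reflections lying in `O⁺` with
determinant `1` is a word in like-sign pairs (row g50-#10, Markman §7), hence a `C`-word.
[cite: GritsenkoHulekSankaran2009, Thm. 1.7 and §4.1] [cite: Markman2023GeneralizedKummers, §7 (opening paragraph)] -/
theorem isWordIn_of_isWordIn_reflections_of_isOrientationPreserving_of_det_eq_one_of_threeHyperbolicPairs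
    (h₁ : TwoHyperbolicPairs B x y x₁ y₁) (h₂ : TwoHyperbolicPairs B x y x₂ y₂) (h₁₂ : TwoHyperbolicPairs B x₁ y₁ x₂ y₂)
    (hev : B.IsEven) (hnd : B.Nondegenerate) {C : Set (B.IsometryEquiv B)}
    (hC : ∀ (l₁ l₂ : List (UGen W)) (hl₁ : ∀ g ∈ l₁, g.IsAdmissible B x y) (hl₂ : ∀ g ∈ l₂, g.IsAdmissible B x y),
      (((UGen.evalEquiv h₁.isSymm h₁.xx h₁.yy l₂ hl₂).symm.trans (UGen.evalEquiv h₁.isSymm h₁.xx h₁.yy l₁ hl₁).symm).trans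
          (UGen.evalEquiv h₁.isSymm h₁.xx h₁.yy l₂ hl₂)).trans (UGen.evalEquiv h₁.isSymm h₁.xx h₁.yy l₁ hl₁) ∈ C)
    {φ : B.IsometryEquiv B}
    (hφ : IsWordIn {ψ : B.IsometryEquiv B | ∃ (r : W) (ε : ℤ) (hε : ε * ε = 1) (hr : B r r = ε + ε),
      ψ = normTwoReflectionEquiv h₁.isSymm r ε hr hε} φ)
    (hO : φ.IsOrientationPreserving) (hdet : LinearMap.det (φ : W →ₗ[ℤ] W) = 1) : IsWordIn C φ :=
  isWordIn_of_isWordIn_likeSignReflectionPairs_of_threeHyperbolicPairs h₁ h₂ h₁₂ hev hC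
    ((isWordIn_likeSignReflectionPairs_iff h₁.isSymm hnd φ).2 ⟨hφ, hO, hdet⟩)

end Generic

/-! ### §2 `SRef₊(L) ⊆ [S̃O⁺(L), S̃O⁺(L)]`; characters; the two classes of `Ref₋₂(L)` -/

section Stable

variable {W : Type u} [AddCommGroup W] [Module.Finite ℤ W] [Module.Free ℤ W] {B : BilinForm ℤ W} {x y x₁ y₁ x₂ y₂ : W}
  {A : Type*} [CommGroup A] {f : B.IsometryEquiv B → A}

/-- The commutators of admissible words are commutators of elements of `S̃O⁺(L)` (admissible words lie in `S̃O⁺(L)`,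
`UGen.evalEquiv_mem_stableSpecialOrthogonal`). [cite: GritsenkoHulekSankaran2009, §3 ("E(L) […] is a subgroup of S̃O⁺(L)")] -/
theorem commutators_evalEquiv_mem_commutators_stableSpecialOrthogonal (h₁ : TwoHyperbolicPairs B x y x₁ y₁) (hnd : B.Nondegenerate)
    (l₁ l₂ : List (UGen W)) (hl₁ : ∀ g ∈ l₁, g.IsAdmissible B x y) (hl₂ : ∀ g ∈ l₂, g.IsAdmissible B x y) :
    (((UGen.evalEquiv h₁.isSymm h₁.xx h₁.yy l₂ hl₂).symm.trans (UGen.evalEquiv h₁.isSymm h₁.xx h₁.yy l₁ hl₁).symm).trans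
        (UGen.evalEquiv h₁.isSymm h₁.xx h₁.yy l₂ hl₂)).trans (UGen.evalEquiv h₁.isSymm h₁.xx h₁.yy l₁ hl₁) ∈
      {ψ : B.IsometryEquiv B | ∃ α β : B.IsometryEquiv B,
        (α.discriminantGroupCongr = LinearEquiv.refl ℤ B.discriminantGroup ∧ α.IsOrientationPreserving ∧
          LinearMap.det (α : W →ₗ[ℤ] W) = 1) ∧
        (β.discriminantGroupCongr = LinearEquiv.refl ℤ B.discriminantGroup ∧ β.IsOrientationPreserving ∧
          LinearMap.det (β : W →ₗ[ℤ] W) = 1) ∧ ψ = ((β.symm.trans α.symm).trans β).trans α} :=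
  ⟨_, _, UGen.evalEquiv_mem_stableSpecialOrthogonal h₁.isSymm hnd h₁.xx h₁.yy l₁ hl₁,
    UGen.evalEquiv_mem_stableSpecialOrthogonal h₁.isSymm hnd h₁.xx h₁.yy l₂ hl₂, rfl⟩

/-- **`SRef₊(L) ⊆ [S̃O⁺(L), S̃O⁺(L)]` — Thm. 1.7 (i) on the reflection part, without Kneser's conditions**: for every symmetric
even non-degenerate lattice with three pairwise orthogonal hyperbolic planes, a word in the `(±2)`-reflections lying in `O⁺`
with determinant `1` is a word in commutators `[α, β]`, `α, β ∈ S̃O⁺(L)`. (With Kneser's `S̃O⁺(L) = ⟨σ_aσ_b⟩` this is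
"`S̃O⁺(L)^{ab}` is trivial".) [cite: GritsenkoHulekSankaran2009, Thm. 1.7, §4.1 and Prop. 3.4 (proof)] [cite: Markman2023GeneralizedKummers, §7 (opening paragraph)] -/
theorem isWordIn_commutators_stableSpecialOrthogonal_of_isWordIn_reflections_of_threeHyperbolicPairs
    (h₁ : TwoHyperbolicPairs B x y x₁ y₁) (h₂ : TwoHyperbolicPairs B x y x₂ y₂) (h₁₂ : TwoHyperbolicPairs B x₁ y₁ x₂ y₂)
    (hev : B.IsEven) (hnd : B.Nondegenerate) {φ : B.IsometryEquiv B}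
    (hφ : IsWordIn {ψ : B.IsometryEquiv B | ∃ (r : W) (ε : ℤ) (hε : ε * ε = 1) (hr : B r r = ε + ε),
      ψ = normTwoReflectionEquiv h₁.isSymm r ε hr hε} φ)
    (hO : φ.IsOrientationPreserving) (hdet : LinearMap.det (φ : W →ₗ[ℤ] W) = 1) :
    IsWordIn {ψ : B.IsometryEquiv B | ∃ α β : B.IsometryEquiv B,
        (α.discriminantGroupCongr = LinearEquiv.refl ℤ B.discriminantGroup ∧ α.IsOrientationPreserving ∧
          LinearMap.det (α : W →ₗ[ℤ] W) = 1) ∧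
        (β.discriminantGroupCongr = LinearEquiv.refl ℤ B.discriminantGroup ∧ β.IsOrientationPreserving ∧
          LinearMap.det (β : W →ₗ[ℤ] W) = 1) ∧ ψ = ((β.symm.trans α.symm).trans β).trans α} φ :=
  isWordIn_of_isWordIn_reflections_of_isOrientationPreserving_of_det_eq_one_of_threeHyperbolicPairs h₁ h₂ h₁₂ hev hnd
    (commutators_evalEquiv_mem_commutators_stableSpecialOrthogonal h₁ hnd) hφ hO hdet

/-- **`Ref_{2ε}(L) ∩ SO(L) ⊆ [S̃O⁺(L), S̃O⁺(L)]`** (one sign; no orientation hypothesis needed: like-sign pairs lie in `SO⁺`): a word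
in the `(2ε)`-reflections of determinant `1` is a word in commutators of `S̃O⁺(L)` — symmetric even non-degenerate `L` with three
hyperbolic planes. [cite: GritsenkoHulekSankaran2009, Thm. 1.7, §4.1 and Prop. 3.4 (proof)] -/
theorem isWordIn_commutators_stableSpecialOrthogonal_of_isWordIn_reflections_of_det_eq_one_of_threeHyperbolicPairs
    (h₁ : TwoHyperbolicPairs B x y x₁ y₁) (h₂ : TwoHyperbolicPairs B x y x₂ y₂) (h₁₂ : TwoHyperbolicPairs B x₁ y₁ x₂ y₂)
    (hev : B.IsEven) (hnd : B.Nondegenerate) {ε : ℤ} (hε : ε * ε = 1) {φ : B.IsometryEquiv B}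
    (hφ : IsWordIn {ψ : B.IsometryEquiv B | ∃ (r : W) (hr : B r r = ε + ε), ψ = normTwoReflectionEquiv h₁.isSymm r ε hr hε} φ)
    (hdet : LinearMap.det (φ : W →ₗ[ℤ] W) = 1) :
    IsWordIn {ψ : B.IsometryEquiv B | ∃ α β : B.IsometryEquiv B,
        (α.discriminantGroupCongr = LinearEquiv.refl ℤ B.discriminantGroup ∧ α.IsOrientationPreserving ∧
          LinearMap.det (α : W →ₗ[ℤ] W) = 1) ∧
        (β.discriminantGroupCongr = LinearEquiv.refl ℤ B.discriminantGroup ∧ β.IsOrientationPreserving ∧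
          LinearMap.det (β : W →ₗ[ℤ] W) = 1) ∧ ψ = ((β.symm.trans α.symm).trans β).trans α} φ :=
  isWordIn_of_isWordIn_reflections_of_det_eq_one_of_threeHyperbolicPairs h₁ h₂ h₁₂ hev
    (commutators_evalEquiv_mem_commutators_stableSpecialOrthogonal h₁ hnd) hε hφ hdet

/-- `[S̃O⁺(L), S̃O⁺(L)]`-words are `[O⁺(L), O⁺(L)]`-words. [cite: GritsenkoHulekSankaran2009, §1 ("S̃O⁺(L) = Õ⁺(L) ∩ SO(L)")] -/
theorem IsWordIn.commutators_isOrientationPreserving_of_stableSpecialOrthogonal {φ : B.IsometryEquiv B}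
    (hφ : IsWordIn {ψ : B.IsometryEquiv B | ∃ α β : B.IsometryEquiv B,
        (α.discriminantGroupCongr = LinearEquiv.refl ℤ B.discriminantGroup ∧ α.IsOrientationPreserving ∧
          LinearMap.det (α : W →ₗ[ℤ] W) = 1) ∧
        (β.discriminantGroupCongr = LinearEquiv.refl ℤ B.discriminantGroup ∧ β.IsOrientationPreserving ∧
          LinearMap.det (β : W →ₗ[ℤ] W) = 1) ∧ ψ = ((β.symm.trans α.symm).trans β).trans α} φ) :
    IsWordIn {ψ : B.IsometryEquiv B | ∃ α β : B.IsometryEquiv B, α.IsOrientationPreserving ∧ β.IsOrientationPreserving ∧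
        ψ = ((β.symm.trans α.symm).trans β).trans α} φ := by
  refine hφ.mono ?_
  rintro ψ ⟨α, β, hα, hβ, h⟩
  exact ⟨α, β, hα.2.1, hβ.2.1, h⟩

/-- **Characters of `O⁺(L)` are `1` on `SRef₊(L)`** (every symmetric even non-degenerate lattice with three hyperbolic planes): a map
to an abelian group multiplicative on `O⁺(L)` is `1` on every `(±2)`-reflection word in `O⁺` of determinant `1`.
[cite: GritsenkoHulekSankaran2009, Cor. 1.8 and Thm. 1.7] -/
theorem character_eq_one_of_isWordIn_reflections_of_threeHyperbolicPairs (h₁ : TwoHyperbolicPairs B x y x₁ y₁)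
    (h₂ : TwoHyperbolicPairs B x y x₂ y₂) (h₁₂ : TwoHyperbolicPairs B x₁ y₁ x₂ y₂) (hev : B.IsEven) (hnd : B.Nondegenerate)
    (hf : ∀ α β : B.IsometryEquiv B, α.IsOrientationPreserving → β.IsOrientationPreserving → f (α.trans β) = f α * f β)
    {φ : B.IsometryEquiv B}
    (hφ : IsWordIn {ψ : B.IsometryEquiv B | ∃ (r : W) (ε : ℤ) (hε : ε * ε = 1) (hr : B r r = ε + ε),
      ψ = normTwoReflectionEquiv h₁.isSymm r ε hr hε} φ)
    (hO : φ.IsOrientationPreserving) (hdet : LinearMap.det (φ : W →ₗ[ℤ] W) = 1) : f φ = 1 :=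
  (character_eq_one_of_isWordIn_commutators_isOrientationPreserving h₁.isSymm hnd hf
    (isWordIn_commutators_stableSpecialOrthogonal_of_isWordIn_reflections_of_threeHyperbolicPairs h₁ h₂ h₁₂ hev hnd hφ hO
      hdet).commutators_isOrientationPreserving_of_stableSpecialOrthogonal).2

/-- **All `(−2)`-reflections have the same image under every character of `O⁺(L)`** — symmetric even non-degenerate `L` with three
hyperbolic planes (`f(σ_a)f(σ_b) = f(σ_aσ_b) = 1 = f(σ_a)²`). [cite: GritsenkoHulekSankaran2009, Cor. 1.8 and Thm. 1.7] -/
theorem character_negTwoReflection_eq_of_threeHyperbolicPairs (h₁ : TwoHyperbolicPairs B x y x₁ y₁)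
    (h₂ : TwoHyperbolicPairs B x y x₂ y₂) (h₁₂ : TwoHyperbolicPairs B x₁ y₁ x₂ y₂) (hev : B.IsEven) (hnd : B.Nondegenerate)
    (hf : ∀ α β : B.IsometryEquiv B, α.IsOrientationPreserving → β.IsOrientationPreserving → f (α.trans β) = f α * f β)
    {a b : W} (ha : B a a = -1 + -1) (hb : B b b = -1 + -1) :
    f (normTwoReflectionEquiv h₁.isSymm a (-1) ha (by norm_num)) = f (normTwoReflectionEquiv h₁.isSymm b (-1) hb (by norm_num)) := by
  have hB := h₁.isSymm
  have hσa : (normTwoReflectionEquiv hB a (-1) ha (by norm_num)).IsOrientationPreserving :=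
    (isOrientationPreserving_normTwoReflectionEquiv_iff _ hB hnd a (-1) ha _).2 rfl
  have hσb : (normTwoReflectionEquiv hB b (-1) hb (by norm_num)).IsOrientationPreserving :=
    (isOrientationPreserving_normTwoReflectionEquiv_iff _ hB hnd b (-1) hb _).2 rfl
  have hab : f (normTwoReflectionEquiv hB a (-1) ha (by norm_num)) * f (normTwoReflectionEquiv hB b (-1) hb (by norm_num)) = 1 := by
    rw [← hf _ _ hσa hσb]
    exact (character_eq_one_of_isWordIn_commutators_isOrientationPreserving hB hnd hf
      ((isWordIn_reflection_trans_reflection_of_threeHyperbolicPairs h₁ h₂ h₁₂ hev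
        (commutators_evalEquiv_mem_commutators_stableSpecialOrthogonal h₁ hnd) (by norm_num) ha
        hb).commutators_isOrientationPreserving_of_stableSpecialOrthogonal)).2
  exact mul_left_cancel ((character_normTwoReflectionEquiv_mul_self hB hnd hf ha).trans hab.symm)

/-- **All `(+2)`-reflections have the same image under every character of `O(L)`** (they do not lie in `O⁺(L)`; `f` multiplicative on
all of `O(L)`) — symmetric even non-degenerate `L` with three hyperbolic planes. [cite: GritsenkoHulekSankaran2009, Cor. 1.8, Cor. 1.2 ("also true with opposite signs") and Thm. 1.7] -/
theorem character_posTwoReflection_eq_of_threeHyperbolicPairs (h₁ : TwoHyperbolicPairs B x y x₁ y₁)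
    (h₂ : TwoHyperbolicPairs B x y x₂ y₂) (h₁₂ : TwoHyperbolicPairs B x₁ y₁ x₂ y₂) (hev : B.IsEven) (hnd : B.Nondegenerate)
    (hf : ∀ α β : B.IsometryEquiv B, f (α.trans β) = f α * f β) {a b : W} (ha : B a a = 1 + 1) (hb : B b b = 1 + 1) :
    f (normTwoReflectionEquiv h₁.isSymm a 1 ha (by norm_num)) = f (normTwoReflectionEquiv h₁.isSymm b 1 hb (by norm_num)) := by
  have hB := h₁.isSymm
  have h1 : f (LinearMap.BilinForm.IsometryEquiv.refl B) = 1 :=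
    map_refl_eq_one_of_map_trans (G := fun _ : B.IsometryEquiv B ↦ True) trivial (fun α β _ _ ↦ hf α β)
  have hsq : ∀ {r : W} (hr : B r r = 1 + 1),
      f (normTwoReflectionEquiv hB r 1 hr (by norm_num)) * f (normTwoReflectionEquiv hB r 1 hr (by norm_num)) = 1 := by
    intro r hr
    rw [← hf, show (normTwoReflectionEquiv hB r 1 hr (by norm_num)).trans (normTwoReflectionEquiv hB r 1 hr (by norm_num)) =
        LinearMap.BilinForm.IsometryEquiv.refl B from DFunLike.ext _ _ fun v ↦ by
          have h := LinearMap.BilinForm.IsometryEquiv.symm_apply_apply (normTwoReflectionEquiv hB r 1 hr (by norm_num)) v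
          rw [normTwoReflectionEquiv_symm] at h
          rw [LinearMap.BilinForm.IsometryEquiv.trans_apply, h, LinearMap.BilinForm.IsometryEquiv.refl_apply], h1]
  have hab : f (normTwoReflectionEquiv hB a 1 ha (by norm_num)) * f (normTwoReflectionEquiv hB b 1 hb (by norm_num)) = 1 := by
    rw [← hf]
    exact (IsWordIn.map_eq_one_of_commutators_of_map_trans (G := fun _ : B.IsometryEquiv B ↦ True) trivial (fun _ _ _ _ ↦ trivial)
      (fun _ _ ↦ trivial) (fun α β _ _ ↦ hf α β) (fun s hs ↦ by obtain ⟨α, β, -, -, h⟩ := hs; exact ⟨α, β, trivial, trivial, h⟩)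
      (isWordIn_reflection_trans_reflection_of_threeHyperbolicPairs h₁ h₂ h₁₂ hev
        (commutators_evalEquiv_mem_commutators_stableSpecialOrthogonal h₁ hnd) (by norm_num) ha hb)).2
  exact mul_left_cancel ((hsq ha).trans hab.symm)

/-- **Characters of `O⁺(L)` factor through `det` on `Ref₋₂(L)`**: two words in the `(−2)`-reflections with equal determinants have the
same image under every character of `O⁺(L)` — symmetric even non-degenerate `L` with three hyperbolic planes.
[cite: GritsenkoHulekSankaran2009, Cor. 1.8 ("only one non-trivial character, namely det") and Thm. 1.7] -/
theorem character_eq_of_isWordIn_negTwoReflections_of_det_eq_of_threeHyperbolicPairs (h₁ : TwoHyperbolicPairs B x y x₁ y₁)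
    (h₂ : TwoHyperbolicPairs B x y x₂ y₂) (h₁₂ : TwoHyperbolicPairs B x₁ y₁ x₂ y₂) (hev : B.IsEven) (hnd : B.Nondegenerate)
    (hf : ∀ α β : B.IsometryEquiv B, α.IsOrientationPreserving → β.IsOrientationPreserving → f (α.trans β) = f α * f β)
    {φ ρ : B.IsometryEquiv B}
    (hφ : IsWordIn {ψ : B.IsometryEquiv B | ∃ (r : W) (hr : B r r = -1 + -1), ψ = normTwoReflectionEquiv h₁.isSymm r (-1) hr (by norm_num)} φ)
    (hρ : IsWordIn {ψ : B.IsometryEquiv B | ∃ (r : W) (hr : B r r = -1 + -1), ψ = normTwoReflectionEquiv h₁.isSymm r (-1) hr (by norm_num)} ρ)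
    (hdet : LinearMap.det (φ : W →ₗ[ℤ] W) = LinearMap.det (ρ : W →ₗ[ℤ] W)) : f φ = f ρ := by
  have hB := h₁.isSymm
  obtain ⟨hS, -⟩ := reflections_symm_mem_and_det hB (ε := -1) (by norm_num)
  have hO : ∀ s ∈ {ψ : B.IsometryEquiv B | ∃ (r : W) (hr : B r r = -1 + -1), ψ = normTwoReflectionEquiv hB r (-1) hr (by norm_num)},
      s.IsOrientationPreserving := by
    rintro s ⟨r, hr, rfl⟩
    exact (isOrientationPreserving_normTwoReflectionEquiv_iff _ hB hnd r (-1) hr _).2 rfl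
  have hφO := hφ.isOrientationPreserving hB hnd hO
  have hρO := hρ.isOrientationPreserving hB hnd hO
  have hρO' : ρ.symm.IsOrientationPreserving := (LinearMap.BilinForm.IsometryEquiv.isOrientationPreserving_symm_iff hB hnd ρ).2 hρO
  have hφρ : IsWordIn {ψ : B.IsometryEquiv B | ∃ (r : W) (hr : B r r = -1 + -1), ψ = normTwoReflectionEquiv hB r (-1) hr (by norm_num)}
      (φ.trans ρ.symm) := hφ.trans hρ.symm
  have hdet' : LinearMap.det ((φ.trans ρ.symm : B.IsometryEquiv B) : W →ₗ[ℤ] W) = 1 := by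
    rw [IsometryEquiv.det_trans_eq_mul, IsometryEquiv.det_symm_eq, hdet]
    rcases LinearMap.BilinForm.IsometryEquiv.det_eq_one_or_eq_neg_one ρ with h | h <;> rw [h] <;> norm_num
  have h1 : f (φ.trans ρ.symm) = 1 :=
    (character_eq_one_of_isWordIn_commutators_isOrientationPreserving hB hnd hf
      ((isWordIn_commutators_stableSpecialOrthogonal_of_isWordIn_reflections_of_det_eq_one_of_threeHyperbolicPairs h₁ h₂ h₁₂
        hev hnd (by norm_num) hφρ hdet').commutators_isOrientationPreserving_of_stableSpecialOrthogonal)).2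
  rw [hf φ ρ.symm hφO hρO', map_symm_eq_inv_of_map_trans (G := fun α : B.IsometryEquiv B ↦ α.IsOrientationPreserving)
    LinearMap.BilinForm.IsometryEquiv.IsOrientationPreserving.refl
    (fun α hα ↦ (LinearMap.BilinForm.IsometryEquiv.isOrientationPreserving_symm_iff hB hnd α).2 hα) hf hρO] at h1
  exact mul_inv_eq_one.1 h1

/-- **`Ref₋₂(L)`-words differ by a `[S̃O⁺(L), S̃O⁺(L)]`-word iff their determinants agree** — symmetric even non-degenerate `L` with
three hyperbolic planes. [cite: GritsenkoHulekSankaran2009, Thm. 1.7 and Thm. 1.3] -/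
theorem isWordIn_commutators_stableSpecialOrthogonal_trans_symm_iff_of_threeHyperbolicPairs
    (h₁ : TwoHyperbolicPairs B x y x₁ y₁) (h₂ : TwoHyperbolicPairs B x y x₂ y₂) (h₁₂ : TwoHyperbolicPairs B x₁ y₁ x₂ y₂)
    (hev : B.IsEven) (hnd : B.Nondegenerate) {φ ρ : B.IsometryEquiv B}
    (hφ : IsWordIn {ψ : B.IsometryEquiv B | ∃ (r : W) (hr : B r r = -1 + -1), ψ = normTwoReflectionEquiv h₁.isSymm r (-1) hr (by norm_num)} φ)
    (hρ : IsWordIn {ψ : B.IsometryEquiv B | ∃ (r : W) (hr : B r r = -1 + -1), ψ = normTwoReflectionEquiv h₁.isSymm r (-1) hr (by norm_num)} ρ) :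
    IsWordIn {ψ : B.IsometryEquiv B | ∃ α β : B.IsometryEquiv B,
        (α.discriminantGroupCongr = LinearEquiv.refl ℤ B.discriminantGroup ∧ α.IsOrientationPreserving ∧
          LinearMap.det (α : W →ₗ[ℤ] W) = 1) ∧
        (β.discriminantGroupCongr = LinearEquiv.refl ℤ B.discriminantGroup ∧ β.IsOrientationPreserving ∧
          LinearMap.det (β : W →ₗ[ℤ] W) = 1) ∧ ψ = ((β.symm.trans α.symm).trans β).trans α} (φ.trans ρ.symm) ↔
      LinearMap.det (φ : W →ₗ[ℤ] W) = LinearMap.det (ρ : W →ₗ[ℤ] W) := by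
  have hB := h₁.isSymm
  constructor
  · intro h
    have hd := h.det_eq_one_of_commutators_of
    rw [IsometryEquiv.det_trans_eq_mul, IsometryEquiv.det_symm_eq] at hd
    have hρ2 : LinearMap.det (ρ : W →ₗ[ℤ] W) * LinearMap.det (ρ : W →ₗ[ℤ] W) = 1 := by
      rcases LinearMap.BilinForm.IsometryEquiv.det_eq_one_or_eq_neg_one ρ with h' | h' <;> simp [h']
    calc LinearMap.det (φ : W →ₗ[ℤ] W)
        = LinearMap.det (ρ : W →ₗ[ℤ] W) * (LinearMap.det (ρ : W →ₗ[ℤ] W) * LinearMap.det (φ : W →ₗ[ℤ] W)) := by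
          rw [← mul_assoc, hρ2, one_mul]
      _ = LinearMap.det (ρ : W →ₗ[ℤ] W) := by rw [hd, mul_one]
  · intro hdet
    have hφρ : IsWordIn {ψ : B.IsometryEquiv B | ∃ (r : W) (hr : B r r = -1 + -1), ψ = normTwoReflectionEquiv hB r (-1) hr (by norm_num)}
        (φ.trans ρ.symm) := hφ.trans hρ.symm
    have hdet' : LinearMap.det ((φ.trans ρ.symm : B.IsometryEquiv B) : W →ₗ[ℤ] W) = 1 := by
      rw [IsometryEquiv.det_trans_eq_mul, IsometryEquiv.det_symm_eq, hdet]
      rcases LinearMap.BilinForm.IsometryEquiv.det_eq_one_or_eq_neg_one ρ with h | h <;> rw [h] <;> norm_num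
    exact isWordIn_commutators_stableSpecialOrthogonal_of_isWordIn_reflections_of_det_eq_one_of_threeHyperbolicPairs h₁ h₂ h₁₂ hev
      hnd (by norm_num) hφρ hdet'

/-- **`|Ref₋₂(L) / [S̃O⁺(L), S̃O⁺(L)]-words| = 2`** for every symmetric even non-degenerate lattice with three hyperbolic planes: the
`(−2)`-reflection words fall into exactly two classes modulo commutator words of `S̃O⁺(L)`, cut out by `det` (`e − f` is a
`(−2)`-vector, so both classes occur). [cite: GritsenkoHulekSankaran2009, Thm. 1.7 ("Õ⁺(L)^{ab} ≅ ℤ/2ℤ") and Thm. 1.3] -/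
theorem natCard_quot_isWordIn_negTwoReflections_commutators_stableSpecialOrthogonal_eq_two_of_threeHyperbolicPairs
    (h₁ : TwoHyperbolicPairs B x y x₁ y₁) (h₂ : TwoHyperbolicPairs B x y x₂ y₂) (h₁₂ : TwoHyperbolicPairs B x₁ y₁ x₂ y₂)
    (hev : B.IsEven) (hnd : B.Nondegenerate) :
    Nat.card (Quot fun φ ρ : {φ : B.IsometryEquiv B // IsWordIn {ψ : B.IsometryEquiv B | ∃ (r : W) (hr : B r r = -1 + -1),
        ψ = normTwoReflectionEquiv h₁.isSymm r (-1) hr (by norm_num)} φ} ↦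
      IsWordIn {ψ : B.IsometryEquiv B | ∃ α β : B.IsometryEquiv B,
        (α.discriminantGroupCongr = LinearEquiv.refl ℤ B.discriminantGroup ∧ α.IsOrientationPreserving ∧
          LinearMap.det (α : W →ₗ[ℤ] W) = 1) ∧
        (β.discriminantGroupCongr = LinearEquiv.refl ℤ B.discriminantGroup ∧ β.IsOrientationPreserving ∧
          LinearMap.det (β : W →ₗ[ℤ] W) = 1) ∧ ψ = ((β.symm.trans α.symm).trans β).trans α} (φ.1.trans ρ.1.symm)) = 2 := by
  classical
  have hB := h₁.isSymm
  have hr : B (x - y) (x - y) = -1 + -1 := by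
    simp only [map_sub, LinearMap.sub_apply, h₁.xx, h₁.yy, h₁.xy, hB.eq y x]
    ring
  rw [show (2 : ℕ) = Nat.card Bool by simp]
  refine natCard_quot_eq_of_forall_iff _ (fun φ ↦ decide (LinearMap.det (φ.1 : W →ₗ[ℤ] W) = 1)) (fun a b ↦ ?_) ?_
  · rw [isWordIn_commutators_stableSpecialOrthogonal_trans_symm_iff_of_threeHyperbolicPairs h₁ h₂ h₁₂ hev hnd a.2 b.2,
      decide_eq_decide]
    rcases LinearMap.BilinForm.IsometryEquiv.det_eq_one_or_eq_neg_one a.1 with ha | ha <;>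
      rcases LinearMap.BilinForm.IsometryEquiv.det_eq_one_or_eq_neg_one b.1 with hb | hb <;> simp [ha, hb]
  · rintro (_ | _)
    · refine ⟨⟨normTwoReflectionEquiv hB (x - y) (-1) hr (by norm_num), IsWordIn.of_mem ⟨x - y, hr, rfl⟩⟩, ?_⟩
      simp [det_normTwoReflectionEquiv _ hB]
    · refine ⟨⟨LinearMap.BilinForm.IsometryEquiv.refl B, IsWordIn.refl⟩, ?_⟩
      simp [specialOrthogonal_refl.2]

end Stable

/-! ### §3 Even unimodular lattices with `n± ≥ 3` (`II_{p,q} ⊇ 3U`, e.g. the K3 lattice `II_{3,19}`) -/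

section Unimodular

variable {V : Type*} [AddCommGroup V] {Q : BilinForm ℤ V} {M₁ : Type*} [AddCommGroup M₁] {R : BilinForm ℤ M₁} {n : ℕ}

/-- **`Λ ≃ Λ' ⊕ U^{⊕n}` with `n ≥ 3` contains three pairwise orthogonal hyperbolic pairs** (pull-backs of `(e₀,f₀), (e₁,f₁), (e₂,f₂)`).
[cite: GritsenkoHulekSankaran2009, §4.1 ("L = U ⊕ U₁ ⊕ U₂ ⊕ L₀")] [cite: Huybrechts2016K3, Ch. 14 Cor. 1.3 (i)] -/
theorem exists_threeHyperbolicPairs_of_equivalent_prod_hyperbolicSum (hs : Q.IsSymm) (hR : R.IsSymm) (hn : 3 ≤ n)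
    (hQ : Q.Equivalent (R.prod (hyperbolicSum n))) :
    ∃ x y x₁ y₁ x₂ y₂ : V, TwoHyperbolicPairs Q x y x₁ y₁ ∧ TwoHyperbolicPairs Q x y x₂ y₂ ∧ TwoHyperbolicPairs Q x₁ y₁ x₂ y₂ := by
  obtain ⟨e⟩ := hQ
  have h01 : (⟨0, by omega⟩ : Fin n) ≠ ⟨1, by omega⟩ := by simp [Fin.ext_iff]
  have h02 : (⟨0, by omega⟩ : Fin n) ≠ ⟨2, by omega⟩ := by simp [Fin.ext_iff]
  have h12 : (⟨1, by omega⟩ : Fin n) ≠ ⟨2, by omega⟩ := by simp [Fin.ext_iff]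
  exact ⟨_, _, _, _, _, _, TwoHyperbolicPairs.of_isometryEquiv hs e (TwoHyperbolicPairs.inr hR (twoHyperbolicPairs_hyperbolicSum h01)),
    TwoHyperbolicPairs.of_isometryEquiv hs e (TwoHyperbolicPairs.inr hR (twoHyperbolicPairs_hyperbolicSum h02)),
    TwoHyperbolicPairs.of_isometryEquiv hs e (TwoHyperbolicPairs.inr hR (twoHyperbolicPairs_hyperbolicSum h12))⟩

variable [Module.Finite ℤ V] [Module.Free ℤ V]

/-- **An even unimodular lattice with `n± ≥ 3` contains three pairwise orthogonal hyperbolic pairs** (`Λ ≃ E₈(±1)^{⊕m} ⊕ U^{⊕ min(n₊,n₋)}`).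
[cite: Huybrechts2016K3, Ch. 14 Cor. 1.3 (i)] [cite: GritsenkoHulekSankaran2009, §4.1] -/
theorem exists_threeHyperbolicPairs_of_isEven_of_isUnimodular (hs : Q.IsSymm) (hu : Q.IsUnimodular) (he : Q.IsEven)
    (h3 : 3 ≤ sigPos Q.toQuadraticMap) (h3' : 3 ≤ sigNeg Q.toQuadraticMap) :
    ∃ x y x₁ y₁ x₂ y₂ : V, TwoHyperbolicPairs Q x y x₁ y₁ ∧ TwoHyperbolicPairs Q x y x₂ y₂ ∧ TwoHyperbolicPairs Q x₁ y₁ x₂ y₂ := by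
  have hi : Q.IsIndefinite :=
    (isIndefinite_iff_sigPos_pos_and_sigNeg_pos_of_isUnimodular hs hu).2 ⟨by omega, by omega⟩
  rcases le_total 0 Q.signature with hσ | hσ
  · obtain ⟨m, -, hQ⟩ := exists_equivalent_pi_e8Form_prod_hyperbolicSum Q hs hu he hi hσ
    exact exists_threeHyperbolicPairs_of_equivalent_prod_hyperbolicSum hs (isSymm_pi_e8Form m) h3' hQ
  · obtain ⟨m, -, hQ⟩ := exists_equivalent_pi_neg_e8Form_prod_hyperbolicSum Q hs hu he hi hσ
    exact exists_threeHyperbolicPairs_of_equivalent_prod_hyperbolicSum hs (IsSymm.pi fun _ ↦ isSymm_e8Form.neg) h3 hQ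

/-- **`SRef₊(L) ⊆ [S̃O⁺(L), S̃O⁺(L)] = [SO⁺(L), SO⁺(L)]` for every even unimodular lattice with `n± ≥ 3`** (all `II_{p,q}`, `p, q ≥ 3`; e.g.
the K3 lattice `II_{3,19}`): a word in the `(±2)`-reflections lying in `O⁺` with determinant `1` is a word in commutators of
`S̃O⁺(L)` — Thm. 1.7 (i) / Prop. 1.6 on the reflection part, with the commutators taken inside `SO⁺` and no Kneser input.
[cite: GritsenkoHulekSankaran2009, Prop. 1.6, Thm. 1.7 and §4.1] [cite: Huybrechts2016K3, Ch. 14 Cor. 1.3 (i)] -/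
theorem isWordIn_commutators_stableSpecialOrthogonal_of_isWordIn_reflections_of_isUnimodular (hs : Q.IsSymm)
    (hu : Q.IsUnimodular) (he : Q.IsEven) (h3 : 3 ≤ sigPos Q.toQuadraticMap) (h3' : 3 ≤ sigNeg Q.toQuadraticMap)
    {φ : Q.IsometryEquiv Q}
    (hφ : IsWordIn {ψ : Q.IsometryEquiv Q | ∃ (r : V) (ε : ℤ) (hε : ε * ε = 1) (hr : Q r r = ε + ε),
      ψ = normTwoReflectionEquiv hs r ε hr hε} φ)
    (hO : φ.IsOrientationPreserving) (hdet : LinearMap.det (φ : V →ₗ[ℤ] V) = 1) :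
    IsWordIn {ψ : Q.IsometryEquiv Q | ∃ α β : Q.IsometryEquiv Q,
        (α.discriminantGroupCongr = LinearEquiv.refl ℤ Q.discriminantGroup ∧ α.IsOrientationPreserving ∧
          LinearMap.det (α : V →ₗ[ℤ] V) = 1) ∧
        (β.discriminantGroupCongr = LinearEquiv.refl ℤ Q.discriminantGroup ∧ β.IsOrientationPreserving ∧
          LinearMap.det (β : V →ₗ[ℤ] V) = 1) ∧ ψ = ((β.symm.trans α.symm).trans β).trans α} φ := by
  obtain ⟨x, y, x₁, y₁, x₂, y₂, h₁, h₂, h₁₂⟩ := exists_threeHyperbolicPairs_of_isEven_of_isUnimodular hs hu he h3 h3'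
  exact isWordIn_commutators_stableSpecialOrthogonal_of_isWordIn_reflections_of_threeHyperbolicPairs h₁ h₂ h₁₂ he hu.nondegenerate
    hφ hO hdet

/-- **`Ref_{2ε}(L) ∩ SO(L) ⊆ [S̃O⁺(L), S̃O⁺(L)]` for every even unimodular lattice with `n± ≥ 3`** (one sign `ε = ±1`): in particular
every product `σ_aσ_b`, `a² = b² = 2ε`, is a commutator word of `S̃O⁺(L) = SO⁺(L)`.
[cite: GritsenkoHulekSankaran2009, Prop. 1.6 (proof), Thm. 1.7 and §4.1] [cite: Huybrechts2016K3, Ch. 14 Cor. 1.3 (i)] -/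
theorem isWordIn_commutators_stableSpecialOrthogonal_of_isWordIn_reflections_of_det_eq_one_of_isUnimodular (hs : Q.IsSymm)
    (hu : Q.IsUnimodular) (he : Q.IsEven) (h3 : 3 ≤ sigPos Q.toQuadraticMap) (h3' : 3 ≤ sigNeg Q.toQuadraticMap) {ε : ℤ}
    (hε : ε * ε = 1) {φ : Q.IsometryEquiv Q}
    (hφ : IsWordIn {ψ : Q.IsometryEquiv Q | ∃ (r : V) (hr : Q r r = ε + ε), ψ = normTwoReflectionEquiv hs r ε hr hε} φ)
    (hdet : LinearMap.det (φ : V →ₗ[ℤ] V) = 1) :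
    IsWordIn {ψ : Q.IsometryEquiv Q | ∃ α β : Q.IsometryEquiv Q,
        (α.discriminantGroupCongr = LinearEquiv.refl ℤ Q.discriminantGroup ∧ α.IsOrientationPreserving ∧
          LinearMap.det (α : V →ₗ[ℤ] V) = 1) ∧
        (β.discriminantGroupCongr = LinearEquiv.refl ℤ Q.discriminantGroup ∧ β.IsOrientationPreserving ∧
          LinearMap.det (β : V →ₗ[ℤ] V) = 1) ∧ ψ = ((β.symm.trans α.symm).trans β).trans α} φ := by
  obtain ⟨x, y, x₁, y₁, x₂, y₂, h₁, h₂, h₁₂⟩ := exists_threeHyperbolicPairs_of_isEven_of_isUnimodular hs hu he h3 h3'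
  exact isWordIn_commutators_stableSpecialOrthogonal_of_isWordIn_reflections_of_det_eq_one_of_threeHyperbolicPairs h₁ h₂ h₁₂ he
    hu.nondegenerate hε hφ hdet

end Unimodular

end Literature.Topology.FourManifolds

end
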